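import Literature.NumberTheory.EllipticCurves.SubgroupSelmer
import HarnessLib

/-!
# Route UniversalToricDescent — two counting lemmas for the (L)-free residual comparison

Lead prover bsd-wall-utd-p1 g13 (`--supports` ♭T′ stmt-BirchSwinnertonDyer-26975; pure group theory used by
`…ResidualCountNoL`). For a homomorphism `Ψ : U → P` of abelian groups and a subgroup `T ≤ P`:
* `natCard_comap_eq_natCard_ker_mul` — `#Ψ⁻¹(T) = #ker Ψ · #(Ψ(U) ∩ T)`;
* `natCard_eq_natCard_quotient_mul_of_sup` — `#T = #(P/Ψ(U)) · #(Ψ(U) ∩ T)` when `Ψ(U) + T = P`.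
(`Nat.card`, valid without finiteness.) THEOREMS ONLY. [folklore]
-/

set_option autoImplicit false
-- `…BirchSwinnertonDyer.BirchSwinnertonDyer.Theorems…` is the problem's mandated namespace (D-0017).
set_option linter.dupNamespace false

namespace Summit.BirchSwinnertonDyer.BirchSwinnertonDyer.Theorems.UniversalToricDescentStrictPlaceTuple

/-! ### §1 Two counting lemmas -/

section Count
variable {U P : Type*} [AddCommGroup U] [AddCommGroup P]

/-- **`#Ψ⁻¹(T) = #ker Ψ · #(Ψ(U) ∩ T)`** (`Nat.card`; the restriction of `Ψ` to `Ψ⁻¹(T)` has kernel `ker Ψ` and image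
`Ψ(U) ∩ T`). [folklore] -/
theorem natCard_comap_eq_natCard_ker_mul (Ψ : U →+ P) (T : AddSubgroup P) :
    Nat.card (T.comap Ψ) = Nat.card Ψ.ker * Nat.card ((Ψ.range).addSubgroupOf T) := by
  -- the restriction `Ψ' : Ψ⁻¹(T) → T`
  let Ψ' : T.comap Ψ →+ T :=
    { toFun := fun u ↦ ⟨Ψ u, u.2⟩
      map_zero' := Subtype.ext (by simp)
      map_add' := fun a b ↦ Subtype.ext (by simp) }
  have hrange : Ψ'.range = (Ψ.range).addSubgroupOf T := by
    ext t
    rw [AddSubgroup.mem_addSubgroupOf, AddMonoidHom.mem_range, AddMonoidHom.mem_range]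
    constructor
    · rintro ⟨u, hu⟩
      exact ⟨u, congrArg Subtype.val hu⟩
    · rintro ⟨u, hu⟩
      have huT : u ∈ T.comap Ψ := by rw [AddSubgroup.mem_comap, hu]; exact t.2
      exact ⟨⟨u, huT⟩, Subtype.ext hu⟩
  have hker : Nat.card Ψ'.ker = Nat.card Ψ.ker := by
    refine Nat.card_congr (Equiv.ofBijective (fun u ↦ (⟨(u : T.comap Ψ), ?_⟩ : Ψ.ker)) ⟨?_, ?_⟩)
    · have h := (AddMonoidHom.mem_ker).mp u.2
      exact (AddMonoidHom.mem_ker).mpr (congrArg Subtype.val h)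
    · intro a b h
      exact Subtype.ext (Subtype.ext (congrArg (fun x : Ψ.ker ↦ (x : U)) h))
    · intro v
      have hv : (v : U) ∈ T.comap Ψ := by
        rw [AddSubgroup.mem_comap, (AddMonoidHom.mem_ker).mp v.2]; exact T.zero_mem
      exact ⟨⟨⟨v, hv⟩, (AddMonoidHom.mem_ker).mpr (Subtype.ext ((AddMonoidHom.mem_ker).mp v.2))⟩, rfl⟩
  rw [AddSubgroup.card_eq_card_quotient_mul_card_addSubgroup Ψ'.ker,
    Nat.card_congr (QuotientAddGroup.quotientKerEquivRange Ψ').toEquiv, hrange, hker, mul_comm]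

/-- **`#T = #(P/Ψ(U)) · #(Ψ(U) ∩ T)` when `Ψ(U) + T = P`** (the projection `T → P/Ψ(U)` is onto with kernel
`Ψ(U) ∩ T`). [folklore] -/
theorem natCard_eq_natCard_quotient_mul_of_sup (Ψ : U →+ P) (T : AddSubgroup P)
    (hsup : ∀ f : P, ∃ u : U, f - Ψ u ∈ T) :
    Nat.card T = Nat.card (P ⧸ Ψ.range) * Nat.card ((Ψ.range).addSubgroupOf T) := by
  let π : T →+ P ⧸ Ψ.range := (QuotientAddGroup.mk' Ψ.range).comp T.subtype
  have hsurj : Function.Surjective π := by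
    intro q
    induction q using QuotientAddGroup.induction_on with
    | H f =>
      obtain ⟨u, hu⟩ := hsup f
      refine ⟨⟨f - Ψ u, hu⟩, ?_⟩
      change QuotientAddGroup.mk (f - Ψ u) = QuotientAddGroup.mk f
      rw [QuotientAddGroup.eq]
      simp
  have hker : π.ker = (Ψ.range).addSubgroupOf T := by
    ext t
    rw [AddMonoidHom.mem_ker, AddSubgroup.mem_addSubgroupOf]
    change QuotientAddGroup.mk (t : P) = (0 : P ⧸ Ψ.range) ↔ _
    rw [QuotientAddGroup.eq_zero_iff]
  rw [AddSubgroup.card_eq_card_quotient_mul_card_addSubgroup π.ker,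
    Nat.card_congr (QuotientAddGroup.quotientKerEquivOfSurjective π hsurj).toEquiv, hker]

end Count


end Summit.BirchSwinnertonDyer.BirchSwinnertonDyer.Theorems.UniversalToricDescentStrictPlaceTuple
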